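import Mathlib
import Summits.ValiantsHypothesis.ValiantsHypothesis.Theses.FeketeSOS
import Summits.ValiantsHypothesis.ValiantsHypothesis.Theorems.FeketeSOSFeketeSOSHardPaleyRIPTameStatus
import Summits.ValiantsHypothesis.ValiantsHypothesis.Theorems.FeketeSOSFeketeSOSHardPaleyRIPTameFold

/-!
# `FeketeSOS.FeketeSOSHard` (stmt-ValiantsHypothesis-3996) — line `paley-rip`, CANDIDATE skeleton v3
# (val-width-3996-p2: stub 3 `stub_tameReduction` replaced by the X-independent `stub_tameOperator`)

Why v3.  In the registered skeleton v2 (`Lines/paley_rip.lean`) stub 3 C = `stub_tameReduction` is the crux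
modulo the engine: `Theorems/…PaleyRIPTameStatus.lean` (p576568) proves X ⇒ C, B(κ,δ₁) ∧ C(κ,δ₁) ⇒ X and
that under B the conclusion of C is unsatisfiable (`mass_gt_of_flatRIPAt`), so C ⇔ "no cheap representation".
The repair census `Lines/paley-rip-stub3-census.md` isolates the one reshape with content independent of X:

* `stub_tameOperator` — OPERATOR TAMENESS `T(r,m)`: for every `ε > 0` there is `K` such that, for every prime
  `p`, every `S ⊆ [0,p)` and every family of `r` weighted squares SUPPORTED IN `S` whose cyclic pattern
  `F` (`deg F < p`, `X^p − 1 ∣ Σ c_i w_i² − F`) has all coefficients of modulus `≤ M`, there is another family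
  of weighted squares supported in `S` with the same cyclic pattern and archimedean mass
  `≤ K · r^K · #S^{1+ε} · M`.  It quantifies over ALL low-rank sparse complex symmetric matrices (objects that
  exist), not over hypothetical cheap representations of `χ_p`; the values of `χ_p` and primality enter the
  line only through the engine B, as `false_without_legendre/prime` require.  Known: true with exponent
  `3/2` for every `r` (spread preimage), true with exponent `1` for `r = 1` (additive-energy identity,
  `Theorems/…PaleyRIPRankOneTame.lean`); `r = 2` (near-zero-divisor pairs `A∗B` in `ℂ[ℤ/p]`) is open.
* `stub_paleyFlatRIP` — the engine B, verbatim from v2 (PaleyRIP beyond `√p`; conjecture-class).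
* Stubs 1 and 4 of v2 are theorems of the tree (p565369, p565617) and are imported, not restated.

Composition (kernel-checked below, sorries only in the two stubs): shrink `κ` to `κ₀ = min(κ,1)`; a cheap
representation (`s ≤ p^δ` squares, support-sum `< p^{1/2+δ}`, degrees `≤ p²`) folds to a cyclic one supported
in the union `S` of the folded supports, `#S < p^{1/2+δ}` (`exists_cyclic_fold`, p576660); its cyclic pattern
is `F_p` itself (`|χ_p| ≤ 1`, so `M = 1`); `T` with `ε = κ₀/2` trades it for squares supported in `S` of mass
`≤ K p^{Kδ} p^{(1/2+δ)(1+κ₀/2)} ≤ p^{1/2+3κ₀/4}` once `δ ≤ κ₀/(4(K+2))` and `p ≥ K^{4/κ₀}`; flat-RIP at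
`(κ₀, δ₁)` forces mass `> p^{1/2+3κ₀/4}` as soon as `p^{1−κ₀/4} < p − 1` (`mass_gt_of_flatRIPAt`, p576568) —
contradiction.

Registration: written as a candidate by the seat val-width-3996-p2 and REGISTERED as the line's skeleton of
record on the director's ruling (director-valiant g9, val-width INBOX 2026-08-27T22:19:48Z: stub 3 of v2 is
promote-stub-class; reshape GO with `stub_paleyFlatRIP` byte-identical so that its prover's landing still
matches).  v2 (`Lines/paley_rip.lean`) stays in the tree for reference (its `massFloor_of` is landed as
`…PaleyRIPMassFloor.lean`).  First rungs of `stub_tameOperator` in the tree: `rankOne_tame` (p578134) and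
`tameOperator_rank_one` (`…PaleyRIPPairing.lean`, p579447: the case `r = 1` in this file's vocabulary).
Nothing here is proved about the crux, and `VP ≠ VNP` is untouched.
-/

set_option linter.unusedVariables false
set_option linter.dupNamespace false

namespace Summit.ValiantsHypothesis.ValiantsHypothesis.Theorems.FeketeSOSHardPaleyRIP

open Polynomial Finset
open scoped BigOperators
open Summit.ValiantsHypothesis.ValiantsHypothesis.Theses

noncomputable section

/-! ## The two open stubs -/

/-- **Stub 2 — flat restricted isometry of the Paley–Hankel matrix beyond the square-root bottleneck
(the engine; conjecture-class; verbatim from skeleton v2).** -/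
theorem stub_paleyFlatRIP :
    ∃ κ : ℝ, 0 < κ ∧ ∃ δ₁ : ℝ, 0 < δ₁ ∧ ∃ p₁ : ℕ, ∀ (p : ℕ) [Fact p.Prime], p₁ ≤ p →
      ∀ (S : Finset ℕ), (∀ a ∈ S, a < p) → (S.card : ℝ) ≤ (p : ℝ) ^ (1 / 2 + δ₁) →
      ∀ (w : ℕ → ℂ), ‖paleyForm p S w‖ ≤ (p : ℝ) ^ (1 / 2 - κ) * ∑ a ∈ S, ‖w a‖ ^ 2 := by
  sorry

/-- **Stub 3′ — operator tameness `T(r,m)` (X-independent replacement of `stub_tameReduction`).**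
For every `ε > 0` there is `K > 0` such that: for every prime `p`, every `r`, every `S ⊆ [0,p)`, every family
`(c_i, w_i)_{i<r}` of weighted squares with `supp w_i ⊆ S`, and every `F` of degree `< p` with
`X^p − 1 ∣ Σ_i c_i w_i² − F` and `|F_n| ≤ M` for all `n`, there are weighted squares `(c'_j, w'_j)` with
`supp w'_j ⊆ S`, `X^p − 1 ∣ Σ_j c'_j w'_j² − F`, and `Σ_j |c'_j|·‖w'_j‖₂² ≤ K · r^K · #S^{1+ε} · M`.
(Any number of new squares; by Takagi this is `min{‖τ'‖_* : τ' ∈ Sym_S, π(τ') = π(τ)} ≤ K r^K #S^{1+ε}‖π(τ)‖_∞`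
for every `τ ∈ Sym_S` of rank `≤ r`.)  Exponent `3/2` is trivial; `r = 1` holds with exponent `1`. -/
theorem stub_tameOperator :
    ∀ ε : ℝ, 0 < ε → ∃ K : ℝ, 0 < K ∧ ∀ (p : ℕ) [Fact p.Prime] (r : ℕ) (S : Finset ℕ), (∀ a ∈ S, a < p) →
      ∀ (c : Fin r → ℂ) (w : Fin r → ℂ[X]), (∀ i, (w i).support ⊆ S) →
      ∀ (F : ℂ[X]) (M : ℝ), F.natDegree < p → ((X : ℂ[X]) ^ p - 1 ∣ (∑ i, C (c i) * w i ^ 2) - F) →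
        (∀ n, ‖F.coeff n‖ ≤ M) →
        ∃ (s' : ℕ) (c' : Fin s' → ℂ) (w' : Fin s' → ℂ[X]), (∀ j, (w' j).support ⊆ S) ∧
          ((X : ℂ[X]) ^ p - 1 ∣ (∑ j, C (c' j) * w' j ^ 2) - F) ∧
          (∑ j, sqMass (c' j) (w' j)) ≤ K * (r : ℝ) ^ K * (S.card : ℝ) ^ (1 + ε) * M := by
  sorry

/-! ## Bookkeeping lemmas for the composition -/

/-- The coefficients of the Fekete polynomial have modulus `≤ 1`. -/
theorem norm_coeff_fek_le_one (p : ℕ) [Fact p.Prime] (n : ℕ) : ‖(fek p).coeff n‖ ≤ 1 := by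
  classical
  unfold fek
  rw [finsetSum_coeff]
  simp only [coeff_C_mul_X_pow]
  rw [Finset.sum_ite_eq (range p) n]
  split_ifs
  · exact norm_chiC_le_one p _
  · simp

/-- `deg F_p < p`. -/
theorem natDegree_fek_lt (p : ℕ) [Fact p.Prime] : (fek p).natDegree < p := by
  have hp : 0 < p := (Fact.out : p.Prime).pos
  unfold fek
  refine lt_of_le_of_lt (natDegree_sum_le_of_forall_le (n := p - 1) (range p) _ fun m hm => ?_)
    (Nat.sub_lt hp one_pos)
  refine (natDegree_C_mul_X_pow_le _ m).trans ?_
  have := mem_range.1 hm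
  omega

/-- A polynomial supported inside `S ⊆ [0,p)` has degree `< p`. -/
theorem natDegree_lt_of_support_subset {p : ℕ} (hp : 0 < p) {S : Finset ℕ} (hS : ∀ a ∈ S, a < p)
    {w : ℂ[X]} (hw : w.support ⊆ S) : w.natDegree < p := by
  by_cases h0 : w = 0
  · rw [h0, natDegree_zero]; exact hp
  · exact hS _ (hw (natDegree_mem_support_of_nonzero h0))

/-- A cyclic representation by squares SUPPORTED IN ONE SET `S` (the union of the folded supports): from
`X^p − 1 ∣ Σ_i c_i g_i² − F_p` (any degrees) to squares `g'_i` with `supp g'_i ⊆ S ⊆ [0,p)`,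
`#S ≤ Σ_i #supp g_i`, and the same cyclic pattern. -/
theorem exists_jointSupport_fold (p : ℕ) [Fact p.Prime] (s : ℕ) (c : Fin s → ℂ) (g : Fin s → ℂ[X])
    (hdvd : (X : ℂ[X]) ^ p - 1 ∣ (∑ i, C (c i) * g i ^ 2) - fek p) :
    ∃ (S : Finset ℕ) (g' : Fin s → ℂ[X]), (∀ a ∈ S, a < p) ∧ (∀ j, (g' j).support ⊆ S) ∧
      ((S.card : ℝ) ≤ ∑ i, ((g i).support.card : ℝ)) ∧
      ((X : ℂ[X]) ^ p - 1 ∣ (∑ j, C (c j) * g' j ^ 2) - fek p) := by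
  classical
  obtain ⟨g', hdeg', hcard', hdvd'⟩ := exists_cyclic_fold p s c g hdvd
  refine ⟨Finset.univ.biUnion fun j => (g' j).support, g', ?_, ?_, ?_, hdvd'⟩
  · intro a ha
    obtain ⟨j, -, hj⟩ := Finset.mem_biUnion.1 ha
    exact lt_of_le_of_lt (le_natDegree_of_mem_supp a hj) (hdeg' j)
  · intro j a ha
    exact Finset.mem_biUnion.2 ⟨j, Finset.mem_univ j, ha⟩
  · calc ((Finset.univ.biUnion fun j => (g' j).support).card : ℝ)
        ≤ ∑ j, ((g' j).support.card : ℝ) := by exact_mod_cast Finset.card_biUnion_le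
      _ ≤ ∑ i, ((g i).support.card : ℝ) := sum_le_sum fun j _ => by exact_mod_cast hcard' j

/-- Real-exponent bookkeeping: with `κ ≤ 1`, `ε = κ/2`, `0 < δ`, `4δ(C+2) ≤ κ`, `s ≤ p^δ`, `m ≤ p^{1/2+δ}` and
`C ≤ p^{κ/4}`, the tame mass bound `C · s^C · m^{1+κ/2}` is at most `p^{1/2 + 3κ/4}`. -/
theorem tame_mass_le {p : ℕ} {κ δ Cc s m : ℝ} (hp : 1 < (p : ℝ)) (hκ : 0 < κ) (hκ1 : κ ≤ 1) (hC : 0 < Cc)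
    (hδ : 0 < δ) (hδle : δ * (4 * (Cc + 2)) ≤ κ) (hs0 : 0 ≤ s) (hs : s ≤ (p : ℝ) ^ δ)
    (hm0 : 0 ≤ m) (hm : m ≤ (p : ℝ) ^ (1 / 2 + δ)) (hCp : Cc ≤ (p : ℝ) ^ (κ / 4)) :
    Cc * s ^ Cc * m ^ (1 + κ / 2) ≤ (p : ℝ) ^ (1 / 2 + 3 * κ / 4) := by
  have hp0 : (0 : ℝ) < p := by linarith
  have h1 : s ^ Cc ≤ (p : ℝ) ^ (δ * Cc) := by
    rw [Real.rpow_mul hp0.le]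
    exact Real.rpow_le_rpow hs0 hs hC.le
  have h2 : m ^ (1 + κ / 2) ≤ (p : ℝ) ^ ((1 / 2 + δ) * (1 + κ / 2)) := by
    rw [Real.rpow_mul hp0.le]
    exact Real.rpow_le_rpow hm0 hm (by linarith)
  have hA : Cc * s ^ Cc ≤ (p : ℝ) ^ (κ / 4) * (p : ℝ) ^ (δ * Cc) :=
    mul_le_mul hCp h1 (Real.rpow_nonneg hs0 _) (Real.rpow_nonneg hp0.le _)
  have hprod : Cc * s ^ Cc * m ^ (1 + κ / 2) ≤
      ((p : ℝ) ^ (κ / 4) * (p : ℝ) ^ (δ * Cc)) * (p : ℝ) ^ ((1 / 2 + δ) * (1 + κ / 2)) :=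
    mul_le_mul hA h2 (Real.rpow_nonneg hm0 _)
      (mul_nonneg (Real.rpow_nonneg hp0.le _) (Real.rpow_nonneg hp0.le _))
  rw [← Real.rpow_add hp0, ← Real.rpow_add hp0] at hprod
  refine hprod.trans (Real.rpow_le_rpow_of_exponent_le hp.le ?_)
  have hexp : (1 / 2 + δ) * (1 + κ / 2) = 1 / 2 + κ / 4 + δ + δ * κ / 2 := by ring
  have hδle' : 4 * (δ * Cc) + 8 * δ ≤ κ := by
    have e : δ * (4 * (Cc + 2)) = 4 * (δ * Cc) + 8 * δ := by ring
    rw [e] at hδle; exact hδle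
  have hδκ : δ * κ ≤ δ * 1 := mul_le_mul_of_nonneg_left hκ1 hδ.le
  rw [hexp]
  linarith

/-- `C ≤ p^{κ/4}` once `C^{4/κ} ≤ p`. -/
theorem const_le_rpow {p : ℕ} {κ Cc : ℝ} (hκ : 0 < κ) (hC : 0 < Cc) (N : ℕ) (hN : Cc ^ (4 / κ) ≤ (N : ℝ))
    (hpN : N ≤ p) : Cc ≤ (p : ℝ) ^ (κ / 4) := by
  have hbase : Cc ^ (4 / κ) ≤ (p : ℝ) := hN.trans (by exact_mod_cast hpN)
  have h0 : (0 : ℝ) ≤ Cc ^ (4 / κ) := Real.rpow_nonneg hC.le _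
  have hmono : (Cc ^ (4 / κ)) ^ (κ / 4) ≤ (p : ℝ) ^ (κ / 4) :=
    Real.rpow_le_rpow h0 hbase (by positivity)
  have hid : (Cc ^ (4 / κ)) ^ (κ / 4) = Cc := by
    rw [← Real.rpow_mul hC.le]
    have : (4 / κ) * (κ / 4) = 1 := by field_simp
    rw [this, Real.rpow_one]
  rw [hid] at hmono
  exact hmono

/-! ## Composition: the crux from stubs 2 and 3′ (stubs 1 and 4 landed) -/

/-- **The crux from the v3 line.**  See the module docstring for the parameter choices
(`κ₀ = min(κ,1)`, `ε = κ₀/2`, `δ = min(δ₁, κ₀/(4(K+2)))`, `η = 3κ₀/4`,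
`p₀ = max(p₁, ⌈K^{4/κ₀}⌉, ⌈2^{4/κ₀}⌉, 3)`). -/
theorem FeketeSOSHard_of : FeketeSOS.FeketeSOSHard := by
  classical
  obtain ⟨κ, hκ, δ₁, hδ₁, p₁, hB⟩ := stub_paleyFlatRIP
  -- shrink κ to κ₀ ≤ 1 (flat-RIP is monotone in the exponent)
  set κ₀ : ℝ := min κ 1 with hκ₀def
  have hκ₀ : 0 < κ₀ := lt_min hκ one_pos
  have hκ₀le : κ₀ ≤ κ := min_le_left _ _
  have hκ₀1 : κ₀ ≤ 1 := min_le_right _ _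
  have hB₀ : ∀ (p : ℕ) [Fact p.Prime], p₁ ≤ p →
      ∀ (S : Finset ℕ), (∀ a ∈ S, a < p) → (S.card : ℝ) ≤ (p : ℝ) ^ (1 / 2 + δ₁) →
      ∀ (w : ℕ → ℂ), ‖paleyForm p S w‖ ≤ (p : ℝ) ^ (1 / 2 - κ₀) * ∑ a ∈ S, ‖w a‖ ^ 2 := by
    intro p _ hp S hS hcard w
    have hp1 : (1 : ℝ) ≤ (p : ℝ) := by exact_mod_cast (Fact.out : p.Prime).one_lt.le
    refine (hB p hp S hS hcard w).trans ?_
    exact mul_le_mul_of_nonneg_right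
      (Real.rpow_le_rpow_of_exponent_le hp1 (by linarith)) (sum_nonneg fun a _ => sq_nonneg _)
  -- operator tameness with ε = κ₀/2
  obtain ⟨Cc, hC, hT⟩ := stub_tameOperator (κ₀ / 2) (by positivity)
  -- δ
  set δ : ℝ := min δ₁ (κ₀ / (4 * (Cc + 2))) with hδdef
  have h4C : (0 : ℝ) < 4 * (Cc + 2) := by positivity
  have hδ : 0 < δ := lt_min hδ₁ (div_pos hκ₀ h4C)
  have hδ₁' : δ ≤ δ₁ := min_le_left _ _
  have hδle : δ * (4 * (Cc + 2)) ≤ κ₀ := by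
    have h : δ ≤ κ₀ / (4 * (Cc + 2)) := min_le_right _ _
    rwa [le_div_iff₀ h4C] at h
  -- thresholds
  obtain ⟨N₁, hN₁⟩ : ∃ N : ℕ, Cc ^ (4 / κ₀) ≤ (N : ℝ) := ⟨_, Nat.le_ceil _⟩
  obtain ⟨N₂, hN₂⟩ : ∃ N : ℕ, (2 : ℝ) ^ (1 / (κ₀ - 3 * κ₀ / 4)) ≤ (N : ℝ) := ⟨_, Nat.le_ceil _⟩
  refine ⟨δ, hδ, max p₁ (max N₁ (max N₂ 3)), ?_⟩
  intro p _ hp s c g hs hdeg hrep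
  have hprime : p.Prime := Fact.out
  have hp₁ : p₁ ≤ p := le_trans (le_max_left _ _) hp
  have hpN₁ : N₁ ≤ p := le_trans (le_trans (le_max_left _ _) (le_max_right _ _)) hp
  have hpN₂ : N₂ ≤ p :=
    le_trans (le_trans (le_trans (le_max_left _ _) (le_max_right _ _)) (le_max_right _ _)) hp
  have hp3 : 3 ≤ p :=
    le_trans (le_trans (le_trans (le_max_right _ _) (le_max_right _ _)) (le_max_right _ _)) hp
  have hp1 : (1 : ℝ) < (p : ℝ) := by exact_mod_cast hprime.one_lt
  have hp0 : (0 : ℝ) < (p : ℝ) := by linarith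
  by_contra hlt
  have hlt' : (∑ i, ((g i).support.card : ℝ)) < (p : ℝ) ^ (1 / 2 + δ) := not_le.1 hlt
  -- fold to one joint support
  have hdvd : (X : ℂ[X]) ^ p - 1 ∣ (∑ i, C (c i) * g i ^ 2) - fek p := by
    have hrep' : (∑ i, C (c i) * g i ^ 2) = fek p := by rw [hrep]; rfl
    rw [hrep', sub_self]; exact dvd_zero _
  obtain ⟨S, g', hS, hsuppS, hcardS, hdvd'⟩ := exists_jointSupport_fold p s c g hdvd
  have hcardS' : (S.card : ℝ) ≤ (p : ℝ) ^ (1 / 2 + δ) := (hcardS.trans_lt hlt').le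
  -- operator tameness with F = F_p, M = 1
  obtain ⟨s', c', w', hsupp', hdvd'', hmass⟩ :=
    hT p s S hS c g' hsuppS (fek p) 1 (natDegree_fek_lt p) hdvd' (norm_coeff_fek_le_one p)
  have hCp : Cc ≤ (p : ℝ) ^ (κ₀ / 4) := const_le_rpow hκ₀ hC N₁ hN₁ hpN₁
  have hmass' : (∑ j, sqMass (c' j) (w' j)) ≤ (p : ℝ) ^ (1 / 2 + 3 * κ₀ / 4) := by
    have h := tame_mass_le (p := p) hp1 hκ₀ hκ₀1 hC hδ hδle (Nat.cast_nonneg s) hs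
      (Nat.cast_nonneg S.card) hcardS' hCp
    calc (∑ j, sqMass (c' j) (w' j)) ≤ Cc * (s : ℝ) ^ Cc * (S.card : ℝ) ^ (1 + κ₀ / 2) * 1 := hmass
      _ = Cc * (s : ℝ) ^ Cc * (S.card : ℝ) ^ (1 + κ₀ / 2) := mul_one _
      _ ≤ (p : ℝ) ^ (1 / 2 + 3 * κ₀ / 4) := h
  -- the new squares are `p^{1/2+δ₁}`-sparse of degree `< p`
  have hdeg'' : ∀ j, (w' j).natDegree < p := fun j =>
    natDegree_lt_of_support_subset hprime.pos hS (hsupp' j)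
  have hsuppcard : ∀ j, ((w' j).support.card : ℝ) ≤ (p : ℝ) ^ (1 / 2 + δ₁) := by
    intro j
    calc ((w' j).support.card : ℝ) ≤ (S.card : ℝ) := by exact_mod_cast Finset.card_le_card (hsupp' j)
      _ ≤ (p : ℝ) ^ (1 / 2 + δ) := hcardS'
      _ ≤ (p : ℝ) ^ (1 / 2 + δ₁) := Real.rpow_le_rpow_of_exponent_le hp1.le (by linarith)
  -- flat-RIP gap and contradiction
  have hηκ : 3 * κ₀ / 4 < κ₀ := by linarith
  have hgap := rpow_gap (p := p) hηκ N₂ hN₂ hpN₂ hp3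
  have hgt := mass_gt_of_flatRIPAt p κ₀ δ₁ (3 * κ₀ / 4) (hB₀ p hp₁) hgap s' c' w' hdeg'' hsuppcard hdvd''
  linarith

/-- The crux, by its conventional closing name. -/
theorem FeketeSOSHard_proof : FeketeSOS.FeketeSOSHard := FeketeSOSHard_of

end

end Summit.ValiantsHypothesis.ValiantsHypothesis.Theorems.FeketeSOSHardPaleyRIP
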